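import Literature.Computability.AlgebraicComplexity.IsotypicOccurrenceSemigroup
import Literature.Computability.AlgebraicComplexity.HessianRank
import HarnessLib

/-!
# Inequalities for Kronecker polytopes from the tangent map (Vergne–Walter's criterion)

Topic `Computability/AlgebraicComplexity`; written while serving the named fact
`vandenBergEtAl2025_unitTensor_four_polytope_maximal` (`UnitTensorMomentPolytope.lean`,
"`Δ(⟨4⟩) = Kron(4,4,4)`"), whose only printed proof route needs the facets of the Kronecker
polytope `Kron(4,4,4)` [Vergne–Walter 2017, §6 and Tables] as THEOREMS about occurring isotypic
types. This file proves the criterion by which Vergne–Walter certify each such facet, in the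
tree's coordinates (occurrence of a partition triple `λ = (λ⁰, λ¹, λ²) ⊢ n` in the tensor power
`s^{⊗n}` of a tensor `s ∈ ℂᵃ ⊗ ℂᵇ ⊗ ℂᶜ` = non-vanishing of the triple isotypic character sum
`isotypicSum₁ λ⁰ ∘ isotypicSum₂ λ¹ ∘ isotypicSum₃ λ²` on `kroneckerPow s n`, as everywhere in
`QuantumFunctionalsUpper.lean`, `IsotypicOccurrenceSemigroup.lean`):

**[VergneWalter2014, Prop. 3.13]** ("partial converse, inspired by the argument of Ressayre"):
let `H = (H_A, H_B, H_C, z)` be integer vectors and `ω(i,j,k) = H_A i + H_B j + H_C k + z` the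
`H`-weight of the basis tensor `eᵢ ⊗ eⱼ ⊗ eₖ`; suppose there is `ψ ∈ ℋ(H ≥ 0)` (a tensor supported
on the basis triples of non-negative `H`-weight) such that the *tangent map*
`𝔫₋ → ℋ(H < 0)`, `X ↦ (X·ψ)|_{ℋ(H<0)}` is surjective, where `𝔫₋` is spanned by the lowering
operators `E_{r r'} ⊗ 1 ⊗ 1`, `1 ⊗ E_{r r'} ⊗ 1`, `1 ⊗ 1 ⊗ E_{r r'}`, `r > r'`. Then
`(H, λ) := ∑ᵢ H_A i λ⁰ᵢ + ∑ⱼ H_B j λ¹ⱼ + ∑ₖ H_C k λ²ₖ + z·n ≥ 0` for every partition triple `λ ⊢ n`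
occurring in `s^{⊗n}` for some tensor `s` — i.e. `(H, -) ≥ 0` is a valid inequality for the
Kronecker polytope `Kron(a,b,c)` (and for every moment polytope `Δ(s) ⊆ Kron(a,b,c)`).
Surjectivity is witnessed, as in [VergneWalter2014, §6.2] ("we have implemented a computer
program"), by an invertible square minor of the tangent map (`tangentEntry`, integer data), so
that the facet lists of `Kron(3,3,3)`, `Kron(4,4,4)`, … become finite certificate checks
(`Kron444Facets.lean`).

## The printed proof and its formalisation

VW, proof of Prop. 3.13: the smooth map `N₋ × ℋ(H ≥ 0) → ℋ`, `(g, φ) ↦ g·φ` has surjective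
differential at `(1, ψ)`, so its image contains a ball; a lowest-weight vector `P` of weight `-λ`
of the coordinate ring (an `N₋`-invariant polynomial) that vanishes on `ℋ(H ≥ 0)` therefore
vanishes identically; and `P|_{ℋ(H ≥ 0)} ≠ 0` forces `-(λ,H) ≤ 0` since all `H`-weights of
polynomials on `ℋ(H ≥ 0)` are non-positive. Here:

* (§4) the covariant `P_ξ(v) = ⟪v^{⊗n}, ξ₁ ⊗ ξ₂ ⊗ ξ₃⟫` attached to a triad of highest-weight vectors
  of weights `λ⁰, λ¹, λ²` in the word models is invariant under LOWER unitriangular triples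
  (tree: `powMat_transpose_mulVec_of_mem_highestWeightSpace` — the transposes are upper
  unitriangular and fix `ξⱼ`); occurrence of `λ` in `s^{⊗n}` gives such a triad with
  `P_ξ((A ⊗ B ⊗ C)s) ≠ 0` (tree: `exists_pairing_ne_zero_of_isotypicSum₁₂₃_kroneckerPow_ne_zero`);
* (§3) if `(H, λ) < 0` then `P_ξ` vanishes on `ℋ(H ≥ 0)`: a word triple `(u,v,w)` with
  `ξ₁(u) ξ₂(v) ξ₃(w) ≠ 0` has contents `λ⁰, λ¹, λ²` (weight vectors are supported on words of the
  right content, `apply_eq_zero_of_mem_highestWeightSpace`), so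
  `∑ₚ ω(uₚ, vₚ, wₚ) = (H, λ) < 0` and some position carries a basis triple of negative `H`-weight,
  where the tensor vanishes;
* (§1, replacing the inverse function theorem) **generic algebraic independence**: if
  `L : σ → k[τ]` has a Jacobian minor with non-zero determinant then `f ↦ f ∘ L` is injective on
  `k[σ]` (`char k = 0`; minimal-degree argument: the partial derivatives of a minimal `f` with
  `f ∘ L = 0` satisfy `((∂ᵢf) ∘ L) · J = 0`, hence vanish by the adjugate identity, so `f` is
  constant); applied (§5–§6) to the polynomial map `(t, φ) ↦ (L_A(t) ⊗ L_B(t) ⊗ L_C(t))·φ`,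
  `L_X(t)` the generic lower unitriangular matrices and `φ` the generic element of `ℋ(H ≥ 0)`,
  whose Jacobian at `(0, ψ)` is block triangular with blocks `1` and the tangent map.

Main results: `hPairing_nonneg_of_occurs_of_det_tangentMinor_ne_zero` (general format
`a × b × c`, integer certificate `(ψ, rows, cols)` with non-zero minor) and its corollaries for
positive Kronecker coefficients (`…_of_kroneckerCoeff_pos`, via a symmetric word function and
`isotypicSum₁₂₃_kroneckerPow_ne_zero_of_pairing_ne_zero`).

## References

* [VergneWalter2014] M. Vergne, M. Walter, *Inequalities for moment cones of finite-dimensional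
  representations*, arXiv:1410.8144 (2014) = J. Symplectic Geom. 15 (2017) 1209–1250, §3.2
  (Prop. 3.13, Def. 3.14, Thm. 1.1/3.15), §6 (Kronecker cones, Example 6.7, Tables).
* [Ressayre2010] N. Ressayre, *Geometric invariant theory and the generalized eigenvalue
  problem*, Invent. Math. 180 (2010), §4 (dominant pairs).
* [BurgisserIkenmeyer2011] P. Bürgisser, C. Ikenmeyer, arXiv:1011.1350, §3.1, §10.1 (semigroup of
  representations via highest weight vectors).
* [FultonHarrisGTM129] W. Fulton, J. Harris, *Representation Theory*, §15.5.
-/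

noncomputable section

open scoped BigOperators Matrix
open MvPolynomial

namespace Literature.Computability.AlgebraicComplexity

open Literature.NumberTheory.DiophantineGeometry (Word wordRep highestWeightSpace Weight wordContent
  prod_eq_prod_pow_wordContent apply_eq_zero_of_mem_highestWeightSpace)

/-! ## §1 Generic algebraic independence from a non-vanishing Jacobian minor -/

section Jacobian

variable {k : Type*} [Field k] {σ τ : Type*}

/-- The partial derivative lowers the total degree of a polynomial, unless it kills it.
[folklore] -/
theorem totalDegree_pderiv_lt_of_ne_zero {f : MvPolynomial σ k} {i : σ} (h : pderiv i f ≠ 0) :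
    (pderiv i f).totalDegree < f.totalDegree := by
  have hpos : 0 < f.totalDegree := by
    rw [pos_iff_ne_zero]
    intro h0
    rw [totalDegree_eq_zero_iff_eq_C] at h0
    exact h (by rw [h0, pderiv_C])
  have hbot : (⊥ : ℕ) < f.totalDegree := hpos
  rw [totalDegree, Finset.sup_lt_iff hbot]
  intro m hm
  rw [mem_support_iff, coeff_pderiv] at hm
  have hc : coeff (m + Finsupp.single i 1) f ≠ 0 := fun h0 => hm (by rw [h0, zero_mul])
  have hle := le_totalDegree (mem_support_iff.2 hc)
  rw [Finsupp.sum_add_index' (fun _ => rfl) (fun _ _ _ => rfl), Finsupp.sum_single_index rfl] at hle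
  exact Nat.lt_of_succ_le hle

/-- In characteristic zero a polynomial all of whose partial derivatives vanish is constant: the
coefficient of `m ≠ 0` is read off from `∂ᵢ f` at `m - eᵢ` for any `i` with `mᵢ ≠ 0`
(`coeff_pderiv`). [folklore] -/
theorem eq_C_coeff_zero_of_pderiv_eq_zero [CharZero k] {f : MvPolynomial σ k}
    (h : ∀ i, pderiv i f = 0) : f = C (coeff 0 f) := by
  classical
  ext m
  rw [coeff_C]
  split_ifs with hm
  · rw [hm]
  · obtain ⟨i, hi⟩ : ∃ i, m i ≠ 0 := by
      by_contra hall
      push Not at hall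
      exact hm (Finsupp.ext fun j => by rw [hall j, Finsupp.zero_apply]).symm
    have key := congrArg (coeff (m - Finsupp.single i 1)) (h i)
    have hmm : m - Finsupp.single i 1 + Finsupp.single i 1 = m := by
      ext j
      simp only [Finsupp.coe_add, Finsupp.coe_tsub, Pi.add_apply, Pi.sub_apply]
      by_cases hij : i = j
      · subst hij
        rw [Finsupp.single_eq_same]
        omega
      · rw [Finsupp.single_apply, if_neg hij]
        omega
    rw [coeff_pderiv, coeff_zero, hmm] at key
    rcases mul_eq_zero.1 key with h1 | h1
    · exact h1
    · exact absurd h1 (Nat.cast_add_one_ne_zero _)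

/-- **Jacobian criterion, easy direction.** Let `L : σ → k[τ]` be polynomials over a field of
characteristic zero and `e : σ → τ` a choice of variables such that the Jacobian minor
`(∂ L_i / ∂ x_{e j})_{i,j}` has non-zero determinant in `k[τ]`. Then the substitution
`f ↦ f(L)` is injective: `aeval L f = 0 → f = 0` (the `L_i` are algebraically independent).
Proof by induction on the total degree: if `f(L) = 0` then by the chain rule
`∑ᵢ (∂ᵢ f)(L) · ∂_{e j} L_i = 0` for all `j`, so `det J · (∂ᵢ f)(L) = 0` by the adjugate identity,
hence `(∂ᵢ f)(L) = 0`, so `∂ᵢ f = 0` by induction, and `f` is a constant, which is `f(L) = 0`.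
[folklore] (Jacobian criterion; used in place of the inverse function theorem of
[VergneWalter2014, proof of Prop. 3.13]) -/
theorem eq_zero_of_aeval_eq_zero_of_det_jacobian_ne_zero [CharZero k] [Fintype σ] [DecidableEq σ]
    (L : σ → MvPolynomial τ k) (e : σ → τ)
    (hJ : (Matrix.of fun i j : σ => pderiv (e j) (L i)).det ≠ 0) {f : MvPolynomial σ k}
    (hf : aeval L f = 0) : f = 0 := by
  induction hn : f.totalDegree using Nat.strong_induction_on generalizing f with
  | _ n ih =>
    set J : Matrix σ σ (MvPolynomial τ k) := Matrix.of fun i j : σ => pderiv (e j) (L i) with hJdef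
    -- the substituted partial derivatives are killed by `J`, hence vanish
    have hpart : ∀ i, aeval L (pderiv i f) = 0 := by
      set w : σ → MvPolynomial τ k := fun i => aeval L (pderiv i f) with hw
      have hwJ : w ᵥ* J = 0 := by
        funext j
        have h := congrArg (pderiv (e j)) hf
        rw [map_zero, pderiv_aeval_eq_sum] at h
        rw [Pi.zero_apply, ← h]
        simp only [Matrix.vecMul, dotProduct, hw, hJdef, Matrix.of_apply]
      have hdet : J.det • w = 0 := by
        have h2 := congrArg (fun v => v ᵥ* J.adjugate) hwJ
        simp only [Matrix.vecMul_vecMul, Matrix.mul_adjugate, Matrix.zero_vecMul,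
          Matrix.vecMul_smul, Matrix.vecMul_one] at h2
        exact h2
      intro i
      have h3 := congrFun hdet i
      rw [Pi.smul_apply, Pi.zero_apply, smul_eq_mul] at h3
      exact (mul_eq_zero.1 h3).resolve_left hJ
    -- by induction every partial derivative of `f` vanishes
    have hzero : ∀ i, pderiv i f = 0 := by
      intro i
      by_contra hne
      have hlt : (pderiv i f).totalDegree < n := hn ▸ totalDegree_pderiv_lt_of_ne_zero hne
      exact hne (ih _ hlt (hpart i) rfl)
    -- so `f` is the constant `f(L) = 0`
    have hC := eq_C_coeff_zero_of_pderiv_eq_zero hzero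
    rw [hC] at hf ⊢
    rw [aeval_C, algebraMap_eq] at hf
    rw [C_eq_zero.1 hf, C_0]

end Jacobian

/-! ## §2 Contents of words and linear functionals of weights -/

section Content

variable {N m : ℕ}

/-- A sum over the letters of a word, grouped by letter: `∑ₚ f(wₚ) = ∑ᵢ contentᵢ(w) • f i`
(additive form of `prod_eq_prod_pow_wordContent`). [folklore] -/
theorem sum_eq_sum_wordContent_smul {M : Type*} [AddCommMonoid M] (f : Fin N → M) (w : Word N m) :
    ∑ p, f (w p) = ∑ i, wordContent w i • f i := by
  have h := prod_eq_prod_pow_wordContent (fun i => Multiplicative.ofAdd (f i)) w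
  apply_fun Multiplicative.toAdd at h
  simpa [toAdd_prod] using h

/-- A highest-weight vector of weight `χ` in the word model is supported on words of content `χ`:
if `ξ(w) ≠ 0` then `contentᵢ(w) = χ i` for every letter `i` (characteristic zero).
[cite: FultonHarrisGTM129, §15.5] -/
theorem wordContent_eq_of_apply_ne_zero {χ : Weight (Fin N)} {ξ : Word N m → ℂ}
    (hξ : ξ ∈ highestWeightSpace (wordRep ℂ N m) χ) {w : Word N m} (hw : ξ w ≠ 0) (i : Fin N) :
    (wordContent w i : ℤ) = χ i := by
  by_contra h
  exact hw (apply_eq_zero_of_mem_highestWeightSpace ℂ hξ h)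

/-- For a highest-weight vector `ξ` of weight `χ` and a word `w` with `ξ(w) ≠ 0`, a linear
functional of the letters sums to the pairing with the weight: `∑ₚ h(wₚ) = ∑ᵢ contentᵢ(w) h i =
∑ᵢ χ i · h i`. [cite: VergneWalter2014, §3.2 (weights of `ℋ(H ≥ 0)`)] -/
theorem sum_apply_eq_sum_weight_mul {χ : Weight (Fin N)} {ξ : Word N m → ℂ}
    (hξ : ξ ∈ highestWeightSpace (wordRep ℂ N m) χ) {w : Word N m} (hw : ξ w ≠ 0) (h : Fin N → ℤ) :
    ∑ p, h (w p) = ∑ i, χ i * h i := by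
  rw [sum_eq_sum_wordContent_smul]
  refine Finset.sum_congr rfl fun i _ => ?_
  rw [← wordContent_eq_of_apply_ne_zero hξ hw i, nsmul_eq_mul]

end Content

/-! ## §3 The covariant vanishes on `ℋ(H ≥ 0)` when `(H, λ) < 0` -/

section Vanishing

variable {a b c n : ℕ}

/-- The `H`-pairing of a partition triple: `(H, λ) = ∑ᵢ H_A i λ⁰ᵢ + ∑ⱼ H_B j λ¹ⱼ + ∑ₖ H_C k λ²ₖ + z n`
for `λ = (λ⁰, λ¹, λ²) ⊢ n` read as weights of `GL_a × GL_b × GL_c` (`Weight.ofPartition`, parts in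
decreasing order padded by zeros). This is the left-hand side of a linear inequality
`(H, λ) ≥ 0` of the Kronecker polytope in the format of [VergneWalter2014, §6, Tables]
("facet format is `(H_A, λ_A) + (H_B, λ_B) + (H_C, λ_C) + z ≥ 0`", normalised there to `n = 1`).
[cite: VergneWalter2014, §6.1] -/
def hPairing (hA : Fin a → ℤ) (hB : Fin b → ℤ) (hC : Fin c → ℤ) (z : ℤ) (lam : Fin 3 → Nat.Partition n) : ℤ :=
  ∑ i, hA i * Weight.ofPartition a (lam 0) i + ∑ j, hB j * Weight.ofPartition b (lam 1) j +
    ∑ l, hC l * Weight.ofPartition c (lam 2) l + z * n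

/-- **The covariant vanishes on `ℋ(H ≥ 0)` when `(H, λ) < 0`.** If `s` is supported on basis
triples of non-negative `H`-weight `ω(i,j,k) = H_A i + H_B j + H_C k + z ≥ 0`, `ξ₁, ξ₂, ξ₃` are
highest-weight vectors of weights `λ⁰, λ¹, λ²` and `(H, λ) < 0`, then
`⟪s^{⊗n}, ξ₁ ⊗ ξ₂ ⊗ ξ₃⟫ = 0`: a contributing word triple has contents `λ⁰, λ¹, λ²`, so its
`H`-weights sum to `(H, λ) < 0` and some position carries a basis triple of negative weight, where
`s` vanishes. [cite: VergneWalter2014, proof of Prop. 3.13 ("all `H`-weights in `R(ℋ(H ≥ 0))` are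
non-positive")] -/
theorem pairing_eq_zero_of_hPairing_neg (hA : Fin a → ℤ) (hB : Fin b → ℤ) (hC : Fin c → ℤ) (z : ℤ)
    {s : Fin a → Fin b → Fin c → ℂ} (hs : ∀ i j l, hA i + hB j + hC l + z < 0 → s i j l = 0)
    {lam : Fin 3 → Nat.Partition n} {ξ₁ : Word a n → ℂ} {ξ₂ : Word b n → ℂ} {ξ₃ : Word c n → ℂ}
    (h₁ : ξ₁ ∈ highestWeightSpace (wordRep ℂ a n) (Weight.ofPartition a (lam 0)))
    (h₂ : ξ₂ ∈ highestWeightSpace (wordRep ℂ b n) (Weight.ofPartition b (lam 1)))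
    (h₃ : ξ₃ ∈ highestWeightSpace (wordRep ℂ c n) (Weight.ofPartition c (lam 2)))
    (hneg : hPairing hA hB hC z lam < 0) :
    ∑ u, ∑ v, ∑ w, kroneckerPow s n u v w * triad ξ₁ ξ₂ ξ₃ u v w = 0 := by
  refine Finset.sum_eq_zero fun u _ => Finset.sum_eq_zero fun v _ => Finset.sum_eq_zero fun w _ => ?_
  rw [triad_apply]
  by_cases hu : ξ₁ u = 0
  · simp [hu]
  by_cases hv : ξ₂ v = 0
  · simp [hv]
  by_cases hw : ξ₃ w = 0
  · simp [hw]
  -- the `H`-weights of the positions sum to `(H, λ) < 0`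
  have hsum : ∑ p, (hA (u p) + hB (v p) + hC (w p) + z) = hPairing hA hB hC z lam := by
    simp only [Finset.sum_add_distrib, Finset.sum_const, Finset.card_univ, Fintype.card_fin,
      hPairing]
    rw [sum_apply_eq_sum_weight_mul h₁ hu hA, sum_apply_eq_sum_weight_mul h₂ hv hB,
      sum_apply_eq_sum_weight_mul h₃ hw hC]
    simp only [mul_comm (hA _), mul_comm (hB _), mul_comm (hC _), nsmul_eq_mul]
    ring
  have hlt : ∑ p, (hA (u p) + hB (v p) + hC (w p) + z) < ∑ _p : Fin n, (0 : ℤ) := by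
    rw [hsum, Finset.sum_const_zero]; exact hneg
  obtain ⟨p, -, hp⟩ := Finset.exists_lt_of_sum_lt hlt
  rw [kroneckerPow_apply, Finset.prod_eq_zero (Finset.mem_univ p) (hs _ _ _ hp), zero_mul]

end Vanishing

/-! ## §4 The covariant is invariant under lower unitriangular triples -/

section Invariance

variable {a b c n : ℕ}

/-- A lower unitriangular matrix acts trivially on highest-weight vectors through `(Aᵀ)^{⊗n}`
(the transpose is upper unitriangular, and the character of a unitriangular matrix is `1`).
[cite: FultonHarrisGTM129, §15.5] -/
theorem powMat_transpose_mulVec_of_lowerUnitriangular {N : ℕ} {lam : Nat.Partition n}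
    {ξ : Word N n → ℂ} (hξ : ξ ∈ highestWeightSpace (wordRep ℂ N n) (Weight.ofPartition N lam))
    {A : Matrix (Fin N) (Fin N) ℂ} (hA : A.BlockTriangular OrderDual.toDual) (hAd : ∀ i, A i i = 1) :
    powMat Aᵀ n *ᵥ ξ = ξ := by
  rw [powMat_transpose_mulVec_of_mem_highestWeightSpace hξ hA (fun i => by rw [hAd i]; exact one_ne_zero)]
  simp [hAd]

/-- **`N₋`-invariance of the covariant.** For lower unitriangular `A, B, C` and a triad of
highest-weight vectors, `⟪((A ⊗ B ⊗ C)s)^{⊗n}, ξ₁ ⊗ ξ₂ ⊗ ξ₃⟫ = ⟪s^{⊗n}, ξ₁ ⊗ ξ₂ ⊗ ξ₃⟫`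
(move the action across the pairing: `(Aᵀ)^{⊗n} ξ₁ = ξ₁`, etc.).
[cite: VergneWalter2014, proof of Prop. 3.13 (lowest weight vectors are `N₋`-invariant)]
[cite: BurgisserIkenmeyer2011, §10.1] -/
theorem pairing_actTensor_of_lowerUnitriangular {lam : Fin 3 → Nat.Partition n}
    {ξ₁ : Word a n → ℂ} {ξ₂ : Word b n → ℂ} {ξ₃ : Word c n → ℂ}
    (h₁ : ξ₁ ∈ highestWeightSpace (wordRep ℂ a n) (Weight.ofPartition a (lam 0)))
    (h₂ : ξ₂ ∈ highestWeightSpace (wordRep ℂ b n) (Weight.ofPartition b (lam 1)))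
    (h₃ : ξ₃ ∈ highestWeightSpace (wordRep ℂ c n) (Weight.ofPartition c (lam 2)))
    {A : Matrix (Fin a) (Fin a) ℂ} {B : Matrix (Fin b) (Fin b) ℂ} {C : Matrix (Fin c) (Fin c) ℂ}
    (hA : A.BlockTriangular OrderDual.toDual) (hAd : ∀ i, A i i = 1)
    (hB : B.BlockTriangular OrderDual.toDual) (hBd : ∀ i, B i i = 1)
    (hC : C.BlockTriangular OrderDual.toDual) (hCd : ∀ i, C i i = 1)
    (s : Fin a → Fin b → Fin c → ℂ) :
    ∑ u, ∑ v, ∑ w, kroneckerPow (actTensor A B C s) n u v w * triad ξ₁ ξ₂ ξ₃ u v w =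
      ∑ u, ∑ v, ∑ w, kroneckerPow s n u v w * triad ξ₁ ξ₂ ξ₃ u v w := by
  rw [kroneckerPow_actTensor_powMat, sum_actTensor_mul, transpose_powMat, transpose_powMat,
    transpose_powMat, actTensor_triad, powMat_transpose_mulVec_of_lowerUnitriangular h₁ hA hAd,
    powMat_transpose_mulVec_of_lowerUnitriangular h₂ hB hBd,
    powMat_transpose_mulVec_of_lowerUnitriangular h₃ hC hCd]

end Invariance

/-! ## §5 The polynomial map `(t, φ) ↦ (L_A(t) ⊗ L_B(t) ⊗ L_C(t))·φ` and the covariant as a polynomial -/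

section Model

variable {a b c n : ℕ}

/-- Variables for the strictly lower entries of three generic lower unitriangular matrices of
sizes `a, b, c` (all pairs `(r, r')` are provided; only those with `r' < r` are used). [folklore] -/
abbrev LVar (a b c : ℕ) : Type := (Fin a × Fin a) ⊕ (Fin b × Fin b) ⊕ (Fin c × Fin c)

/-- All variables of the polynomial model: the lowering entries `LVar` and the coordinates of the
generic tensor of `ℂᵃ ⊗ ℂᵇ ⊗ ℂᶜ`. [folklore] -/
abbrev MVar (a b c : ℕ) : Type := LVar a b c ⊕ (Fin a × Fin b × Fin c)

/-- The generic lower unitriangular `N × N` matrix over a polynomial ring: `1` on the diagonal,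
the variable `emb (i, i')` at a strictly lower position `(i, i')`, `i' < i`, and `0` above the
diagonal (a parametrisation of the negative unipotent group `N₋` of
[VergneWalter2014, §3.1–3.2]). [cite: VergneWalter2014, §3.2] -/
def genLower {V : Type*} (N : ℕ) (emb : Fin N × Fin N → V) : Matrix (Fin N) (Fin N) (MvPolynomial V ℂ) :=
  fun i i' => if i = i' then 1 else if i' < i then X (emb (i, i')) else 0

/-- Partial derivatives of the generic lower unitriangular matrix. [folklore] -/
theorem pderiv_genLower {V : Type*} [DecidableEq V] (N : ℕ) (emb : Fin N × Fin N → V) (v : V)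
    (i i' : Fin N) :
    pderiv v (genLower N emb i i') = if i' < i ∧ emb (i, i') = v then 1 else 0 := by
  unfold genLower
  by_cases h1 : i = i'
  · subst h1
    simp
  · rw [if_neg h1]
    by_cases h2 : i' < i
    · rw [if_pos h2, pderiv_X, Pi.single_apply]
      by_cases h3 : emb (i, i') = v <;> simp [h2, h3]
    · rw [if_neg h2, map_zero, if_neg (fun h => h2 h.1)]

/-- Evaluating the generic lower unitriangular matrix. [folklore] -/
theorem eval_genLower {V : Type*} (N : ℕ) (emb : Fin N × Fin N → V) (y : V → ℂ) (i i' : Fin N) :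
    eval y (genLower N emb i i') = if i = i' then 1 else if i' < i then y (emb (i, i')) else 0 := by
  unfold genLower
  split_ifs <;> simp

/-- At a point where all lowering variables vanish the generic lower unitriangular matrix is the
identity. [folklore] -/
theorem eval_genLower_of_eq_zero {V : Type*} (N : ℕ) (emb : Fin N × Fin N → V) {y : V → ℂ}
    (hy : ∀ q, y (emb q) = 0) (i i' : Fin N) :
    eval y (genLower N emb i i') = if i = i' then 1 else 0 := by
  rw [eval_genLower]
  split_ifs <;> simp [hy]

/-- Every evaluation of the generic lower unitriangular matrix is lower triangular … [folklore] -/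
theorem blockTriangular_genLower_map_eval {V : Type*} (N : ℕ) (emb : Fin N × Fin N → V)
    (y : V → ℂ) : ((genLower N emb).map (eval y)).BlockTriangular OrderDual.toDual := by
  intro i j hij
  have hij' : i < j := OrderDual.toDual_lt_toDual.1 hij
  rw [Matrix.map_apply, eval_genLower, if_neg (ne_of_lt hij'), if_neg (not_lt.2 hij'.le)]

/-- … with unit diagonal. [folklore] -/
theorem genLower_map_eval_diag {V : Type*} (N : ℕ) (emb : Fin N × Fin N → V) (y : V → ℂ)
    (i : Fin N) : ((genLower N emb).map (eval y)) i i = 1 := by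
  rw [Matrix.map_apply, eval_genLower, if_pos rfl]

/-- The generic element of `ℋ(H ≥ 0)`: the coordinate variable at the basis triples of
non-negative `H`-weight `ω(i,j,l) = H_A i + H_B j + H_C l + z`, and `0` elsewhere.
[cite: VergneWalter2014, §3.2 (the subspace `ℋ(H ≥ 0)`)] -/
def genNonneg (hA : Fin a → ℤ) (hB : Fin b → ℤ) (hC : Fin c → ℤ) (z : ℤ) :
    Fin a → Fin b → Fin c → MvPolynomial (MVar a b c) ℂ :=
  fun i j l => if 0 ≤ hA i + hB j + hC l + z then X (Sum.inr (i, j, l)) else 0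

/-- **The polynomial map `Φ : (t, φ) ↦ (L_A(t) ⊗ L_B(t) ⊗ L_C(t))·φ`** on `N₋ × ℋ(H ≥ 0)`: the
coordinates of the action of the three generic lower unitriangular matrices on the generic
element of `ℋ(H ≥ 0)` (`actTensor` over the polynomial ring).
[cite: VergneWalter2014, proof of Prop. 3.13 (the map `N₋ × ℋ(H ≥ 0) → ℋ`)] -/
def genImage (hA : Fin a → ℤ) (hB : Fin b → ℤ) (hC : Fin c → ℤ) (z : ℤ)
    (ρ : Fin a × Fin b × Fin c) : MvPolynomial (MVar a b c) ℂ :=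
  actTensor (genLower a (fun q => (Sum.inl (Sum.inl q) : MVar a b c)))
    (genLower b (fun q => (Sum.inl (Sum.inr (Sum.inl q)) : MVar a b c)))
    (genLower c (fun q => (Sum.inl (Sum.inr (Sum.inr q)) : MVar a b c)))
    (genNonneg hA hB hC z) ρ.1 ρ.2.1 ρ.2.2

variable (n) in
/-- **The covariant as a polynomial**: `P_ξ = ∑_{u,v,w} (ξ₁(u) ξ₂(v) ξ₃(w)) ∏ₚ X_{(uₚ, vₚ, wₚ)}`, a
polynomial in the tensor coordinates with `P_ξ(s) = ⟪s^{⊗n}, ξ₁ ⊗ ξ₂ ⊗ ξ₃⟫` (`eval_pairingPoly`).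
[cite: BurgisserIkenmeyer2011, §3.1 and §10.1 (highest weight vectors of the coordinate ring)] -/
def pairingPoly (ξ₁ : Word a n → ℂ) (ξ₂ : Word b n → ℂ) (ξ₃ : Word c n → ℂ) :
    MvPolynomial (Fin a × Fin b × Fin c) ℂ :=
  ∑ u : Word a n, ∑ v : Word b n, ∑ w : Word c n,
    C (triad ξ₁ ξ₂ ξ₃ u v w) * ∏ p, X (u p, v p, w p)

/-- `P_ξ(s) = ⟪s^{⊗n}, ξ₁ ⊗ ξ₂ ⊗ ξ₃⟫`. [folklore] -/
theorem eval_pairingPoly (ξ₁ : Word a n → ℂ) (ξ₂ : Word b n → ℂ) (ξ₃ : Word c n → ℂ)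
    (x : Fin a × Fin b × Fin c → ℂ) :
    eval x (pairingPoly n ξ₁ ξ₂ ξ₃) =
      ∑ u, ∑ v, ∑ w, kroneckerPow (fun i j l => x (i, j, l)) n u v w * triad ξ₁ ξ₂ ξ₃ u v w := by
  simp only [pairingPoly, map_sum, map_mul, eval_C, map_prod, eval_X, kroneckerPow_apply]
  exact Finset.sum_congr rfl fun u _ => Finset.sum_congr rfl fun v _ =>
    Finset.sum_congr rfl fun w _ => mul_comm _ _

/-- A non-vanishing pairing `⟪t^{⊗n}, ξ₁ ⊗ ξ₂ ⊗ ξ₃⟫ ≠ 0` shows `P_ξ ≠ 0`. [folklore] -/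
theorem pairingPoly_ne_zero {ξ₁ : Word a n → ℂ} {ξ₂ : Word b n → ℂ} {ξ₃ : Word c n → ℂ}
    {t : Fin a → Fin b → Fin c → ℂ}
    (h : ∑ u, ∑ v, ∑ w, kroneckerPow t n u v w * triad ξ₁ ξ₂ ξ₃ u v w ≠ 0) :
    pairingPoly n ξ₁ ξ₂ ξ₃ ≠ 0 := by
  intro h0
  apply h
  have := eval_pairingPoly ξ₁ ξ₂ ξ₃ (fun ρ => t ρ.1 ρ.2.1 ρ.2.2)
  rw [h0, map_zero] at this
  exact this.symm

/-- Evaluating `Φ` at a point: the action of the evaluated (numerical, lower unitriangular)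
matrices on the evaluated element of `ℋ(H ≥ 0)`. [folklore] -/
theorem eval_genImage (hA : Fin a → ℤ) (hB : Fin b → ℤ) (hC : Fin c → ℤ) (z : ℤ)
    (y : MVar a b c → ℂ) (ρ : Fin a × Fin b × Fin c) :
    eval y (genImage hA hB hC z ρ) =
      actTensor ((genLower a (fun q => (Sum.inl (Sum.inl q) : MVar a b c))).map (eval y))
        ((genLower b (fun q => (Sum.inl (Sum.inr (Sum.inl q)) : MVar a b c))).map (eval y))
        ((genLower c (fun q => (Sum.inl (Sum.inr (Sum.inr q)) : MVar a b c))).map (eval y))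
        (fun i j l => eval y (genNonneg hA hB hC z i j l)) ρ.1 ρ.2.1 ρ.2.2 := by
  simp only [genImage, actTensor_apply, map_sum, map_mul, Matrix.map_apply]

/-- The evaluated element of `ℋ(H ≥ 0)` vanishes at basis triples of negative `H`-weight.
[folklore] -/
theorem eval_genNonneg_eq_zero (hA : Fin a → ℤ) (hB : Fin b → ℤ) (hC : Fin c → ℤ) (z : ℤ)
    (y : MVar a b c → ℂ) {i : Fin a} {j : Fin b} {l : Fin c} (h : hA i + hB j + hC l + z < 0) :
    eval y (genNonneg hA hB hC z i j l) = 0 := by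
  simp [genNonneg, not_le.2 h]

/-- `ℂ` is infinite (for `MvPolynomial.funext`). [folklore] -/
instance instInfiniteComplex : Infinite ℂ := Infinite.of_injective _ Nat.cast_injective

/-- **`P_ξ ∘ Φ = 0` when `(H, λ) < 0`.** The covariant of a triad of highest-weight vectors of
weights `λ⁰, λ¹, λ²` with `(H, λ) < 0` vanishes identically on the image of
`Φ : N₋ × ℋ(H ≥ 0) → ℋ`: by `N₋`-invariance (§4) its value at `Φ(t, φ)` is its value at
`φ ∈ ℋ(H ≥ 0)`, which is `0` (§3); a polynomial over `ℂ` vanishing at every point is `0`.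
[cite: VergneWalter2014, proof of Prop. 3.13] -/
theorem aeval_genImage_pairingPoly_eq_zero (hA : Fin a → ℤ) (hB : Fin b → ℤ) (hC : Fin c → ℤ)
    (z : ℤ) {lam : Fin 3 → Nat.Partition n} {ξ₁ : Word a n → ℂ} {ξ₂ : Word b n → ℂ}
    {ξ₃ : Word c n → ℂ}
    (h₁ : ξ₁ ∈ highestWeightSpace (wordRep ℂ a n) (Weight.ofPartition a (lam 0)))
    (h₂ : ξ₂ ∈ highestWeightSpace (wordRep ℂ b n) (Weight.ofPartition b (lam 1)))
    (h₃ : ξ₃ ∈ highestWeightSpace (wordRep ℂ c n) (Weight.ofPartition c (lam 2)))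
    (hneg : hPairing hA hB hC z lam < 0) :
    aeval (genImage hA hB hC z) (pairingPoly n ξ₁ ξ₂ ξ₃) = 0 := by
  apply MvPolynomial.funext
  intro y
  rw [map_zero, eval_aeval_eq_eval, eval_pairingPoly]
  have hfun : (fun i j l => eval y (genImage hA hB hC z (i, j, l))) =
      actTensor ((genLower a (fun q => (Sum.inl (Sum.inl q) : MVar a b c))).map (eval y))
        ((genLower b (fun q => (Sum.inl (Sum.inr (Sum.inl q)) : MVar a b c))).map (eval y))
        ((genLower c (fun q => (Sum.inl (Sum.inr (Sum.inr q)) : MVar a b c))).map (eval y))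
        (fun i j l => eval y (genNonneg hA hB hC z i j l)) := by
    funext i j l
    exact eval_genImage hA hB hC z y (i, j, l)
  rw [hfun, pairing_actTensor_of_lowerUnitriangular h₁ h₂ h₃ (blockTriangular_genLower_map_eval _ _ y)
    (genLower_map_eval_diag _ _ y) (blockTriangular_genLower_map_eval _ _ y)
    (genLower_map_eval_diag _ _ y) (blockTriangular_genLower_map_eval _ _ y)
    (genLower_map_eval_diag _ _ y)]
  exact pairing_eq_zero_of_hPairing_neg hA hB hC z
    (fun i j l h => eval_genNonneg_eq_zero hA hB hC z y h) h₁ h₂ h₃ hneg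

end Model

/-! ## §6 The Jacobian of `Φ` at `(1, ψ)`: the tangent map -/

section Tangent

variable {a b c : ℕ}

/-- **The tangent map in coordinates.** For an integer tensor `ψ` the entry of the tangent map
`𝔫₋ → ℋ`, `X ↦ X·ψ` at the basis triple `(i, j, l)` (row) and the lowering operator indexed by a
variable of `LVar` (column): the operator `E_{r r'} ⊗ 1 ⊗ 1`, `r' < r` (sending `e_{r'} ↦ e_r` in
the first factor) contributes `ψ_{r' j l}` to the row `(r, j, l)`; similarly for the other two
factors; columns `(r, r')` with `r ≤ r'` are not lowering operators and are set to `0`.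
[cite: VergneWalter2014, Prop. 3.13 and Def. 3.14 (the map `X ↦ π(X) ψ`)] -/
def tangentEntry (ψ : Fin a → Fin b → Fin c → ℤ) : Fin a × Fin b × Fin c → LVar a b c → ℤ
  | ⟨i, j, l⟩, Sum.inl (r, r') => if i = r ∧ r' < r then ψ r' j l else 0
  | ⟨i, j, l⟩, Sum.inr (Sum.inl (r, r')) => if j = r ∧ r' < r then ψ i r' l else 0
  | ⟨i, j, l⟩, Sum.inr (Sum.inr (r, r')) => if l = r ∧ r' < r then ψ i j r' else 0

/-- The base point `(t, φ) = (0, ψ)` of the polynomial model, i.e. `(1, ψ) ∈ N₋ × ℋ(H ≥ 0)`.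
[cite: VergneWalter2014, proof of Prop. 3.13] -/
def basePoint (ψ : Fin a → Fin b → Fin c → ℤ) : MVar a b c → ℂ :=
  Sum.elim (fun _ => 0) (fun ρ => (ψ ρ.1 ρ.2.1 ρ.2.2 : ℂ))

/-- The lowering coordinates of the base point vanish. [folklore] -/
@[simp] theorem basePoint_inl (ψ : Fin a → Fin b → Fin c → ℤ) (t : LVar a b c) :
    basePoint ψ (Sum.inl t) = 0 := rfl

/-- The tensor coordinates of the base point are those of `ψ`. [folklore] -/
@[simp] theorem basePoint_inr (ψ : Fin a → Fin b → Fin c → ℤ) (ρ : Fin a × Fin b × Fin c) :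
    basePoint ψ (Sum.inr ρ) = (ψ ρ.1 ρ.2.1 ρ.2.2 : ℂ) := rfl

/-- At the base point the generic element of `ℋ(H ≥ 0)` is `ψ` (for `ψ ∈ ℋ(H ≥ 0)`). [folklore] -/
theorem eval_basePoint_genNonneg (hA : Fin a → ℤ) (hB : Fin b → ℤ) (hC : Fin c → ℤ) (z : ℤ)
    {ψ : Fin a → Fin b → Fin c → ℤ} (hψ : ∀ i j l, hA i + hB j + hC l + z < 0 → ψ i j l = 0)
    (i : Fin a) (j : Fin b) (l : Fin c) :
    eval (basePoint ψ) (genNonneg hA hB hC z i j l) = (ψ i j l : ℂ) := by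
  unfold genNonneg
  split_ifs with h
  · simp
  · rw [map_zero, hψ i j l (not_le.1 h), Int.cast_zero]

/-- Partial derivatives of the generic element of `ℋ(H ≥ 0)`. [folklore] -/
theorem pderiv_genNonneg (hA : Fin a → ℤ) (hB : Fin b → ℤ) (hC : Fin c → ℤ) (z : ℤ)
    (v : MVar a b c) (i : Fin a) (j : Fin b) (l : Fin c) :
    pderiv v (genNonneg hA hB hC z i j l) =
      if 0 ≤ hA i + hB j + hC l + z ∧ (Sum.inr (i, j, l) : MVar a b c) = v then 1 else 0 := by
  classical
  unfold genNonneg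
  by_cases h : 0 ≤ hA i + hB j + hC l + z
  · rw [if_pos h, pderiv_X, Pi.single_apply]
    by_cases h' : (Sum.inr (i, j, l) : MVar a b c) = v <;> simp [h, h']
  · rw [if_neg h, map_zero, if_neg (fun h' => h h'.1)]

/-- **The Jacobian of `Φ` at the base point, lowering columns = the tangent map**:
`∂Φ_ρ/∂t_v (0, ψ) = tangentEntry ψ ρ v`. [cite: VergneWalter2014, proof of Prop. 3.13
("its differential at `(1, ψ)` is `(X, V) ↦ π(X)ψ + V`")] -/
theorem eval_basePoint_pderiv_inl_genImage (hA : Fin a → ℤ) (hB : Fin b → ℤ) (hC : Fin c → ℤ)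
    (z : ℤ) {ψ : Fin a → Fin b → Fin c → ℤ} (hψ : ∀ i j l, hA i + hB j + hC l + z < 0 → ψ i j l = 0)
    (v : LVar a b c) (ρ : Fin a × Fin b × Fin c) :
    eval (basePoint ψ) (pderiv (Sum.inl v) (genImage hA hB hC z ρ)) = (tangentEntry ψ ρ v : ℂ) := by
  classical
  obtain ⟨i, j, l⟩ := ρ
  have hLA : ∀ i i' : Fin a, eval (basePoint ψ)
      (genLower a (fun q => (Sum.inl (Sum.inl q) : MVar a b c)) i i') = if i = i' then 1 else 0 :=
    eval_genLower_of_eq_zero _ _ (fun q => rfl)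
  have hLB : ∀ j j' : Fin b, eval (basePoint ψ)
      (genLower b (fun q => (Sum.inl (Sum.inr (Sum.inl q)) : MVar a b c)) j j') =
        if j = j' then 1 else 0 :=
    eval_genLower_of_eq_zero _ _ (fun q => rfl)
  have hLC : ∀ l l' : Fin c, eval (basePoint ψ)
      (genLower c (fun q => (Sum.inl (Sum.inr (Sum.inr q)) : MVar a b c)) l l') =
        if l = l' then 1 else 0 :=
    eval_genLower_of_eq_zero _ _ (fun q => rfl)
  simp only [genImage, actTensor_apply, map_sum, pderiv_mul, map_add, map_mul,
    pderiv_genLower, pderiv_genNonneg, hLA, hLB, hLC,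
    eval_basePoint_genNonneg hA hB hC z hψ, apply_ite (eval (basePoint ψ)), map_one, map_zero]
  rcases v with ⟨r, r'⟩ | ⟨r, r'⟩ | ⟨r, r'⟩
  · rw [Finset.sum_eq_single r' (fun x _ hx => by simp [hx]) (by simp),
      Finset.sum_eq_single j (fun y _ hy => by simp [Ne.symm hy]) (by simp),
      Finset.sum_eq_single l (fun w _ hw => by simp [Ne.symm hw]) (by simp)]
    by_cases h : i = r ∧ r' < r
    · obtain ⟨rfl, h'⟩ := h
      simp [tangentEntry, h']
    · simp only [tangentEntry, if_neg h]
      simp only [not_and, not_lt] at h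
      by_cases h1 : i = r
      · subst h1; simp [not_lt.2 (h rfl)]
      · simp [h1]
  · rw [Finset.sum_eq_single i (fun x _ hx => by simp [Ne.symm hx]) (by simp),
      Finset.sum_eq_single r' (fun y _ hy => by simp [hy]) (by simp),
      Finset.sum_eq_single l (fun w _ hw => by simp [Ne.symm hw]) (by simp)]
    by_cases h : j = r ∧ r' < r
    · obtain ⟨rfl, h'⟩ := h
      simp [tangentEntry, h']
    · simp only [tangentEntry, if_neg h]
      simp only [not_and, not_lt] at h
      by_cases h1 : j = r
      · subst h1; simp [not_lt.2 (h rfl)]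
      · simp [h1]
  · rw [Finset.sum_eq_single i (fun x _ hx => by simp [Ne.symm hx]) (by simp),
      Finset.sum_eq_single j (fun y _ hy => by simp [Ne.symm hy]) (by simp),
      Finset.sum_eq_single r' (fun w _ hw => by simp [hw]) (by simp)]
    by_cases h : l = r ∧ r' < r
    · obtain ⟨rfl, h'⟩ := h
      simp [tangentEntry, h']
    · simp only [tangentEntry, if_neg h]
      simp only [not_and, not_lt] at h
      by_cases h1 : l = r
      · subst h1; simp [not_lt.2 (h rfl)]
      · simp [h1]

/-- **The Jacobian of `Φ` at the base point, `ℋ(H ≥ 0)` columns = the identity**: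
`∂Φ_ρ/∂φ_{ρ₀} (0, ψ) = [ρ = ρ₀]` for a basis triple `ρ₀` of non-negative `H`-weight (and `0` for
the unused coordinates of negative weight). [cite: VergneWalter2014, proof of Prop. 3.13] -/
theorem eval_basePoint_pderiv_inr_genImage (hA : Fin a → ℤ) (hB : Fin b → ℤ) (hC : Fin c → ℤ)
    (z : ℤ) {ψ : Fin a → Fin b → Fin c → ℤ} (hψ : ∀ i j l, hA i + hB j + hC l + z < 0 → ψ i j l = 0)
    (ρ₀ ρ : Fin a × Fin b × Fin c) :
    eval (basePoint ψ) (pderiv (Sum.inr ρ₀) (genImage hA hB hC z ρ)) =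
      if ρ = ρ₀ ∧ 0 ≤ hA ρ₀.1 + hB ρ₀.2.1 + hC ρ₀.2.2 + z then 1 else 0 := by
  classical
  obtain ⟨i, j, l⟩ := ρ
  obtain ⟨i₀, j₀, l₀⟩ := ρ₀
  have hLA : ∀ i i' : Fin a, eval (basePoint ψ)
      (genLower a (fun q => (Sum.inl (Sum.inl q) : MVar a b c)) i i') = if i = i' then 1 else 0 :=
    eval_genLower_of_eq_zero _ _ (fun q => rfl)
  have hLB : ∀ j j' : Fin b, eval (basePoint ψ)
      (genLower b (fun q => (Sum.inl (Sum.inr (Sum.inl q)) : MVar a b c)) j j') =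
        if j = j' then 1 else 0 :=
    eval_genLower_of_eq_zero _ _ (fun q => rfl)
  have hLC : ∀ l l' : Fin c, eval (basePoint ψ)
      (genLower c (fun q => (Sum.inl (Sum.inr (Sum.inr q)) : MVar a b c)) l l') =
        if l = l' then 1 else 0 :=
    eval_genLower_of_eq_zero _ _ (fun q => rfl)
  simp only [genImage, actTensor_apply, map_sum, pderiv_mul, map_add, map_mul,
    pderiv_genLower, pderiv_genNonneg, hLA, hLB, hLC,
    eval_basePoint_genNonneg hA hB hC z hψ, apply_ite (eval (basePoint ψ)), map_one, map_zero]
  rw [Finset.sum_eq_single i (fun x _ hx => by simp [Ne.symm hx]) (by simp),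
    Finset.sum_eq_single j (fun y _ hy => by simp [Ne.symm hy]) (by simp),
    Finset.sum_eq_single l (fun w _ hw => by simp [Ne.symm hw]) (by simp)]
  by_cases h : ((i, j, l) : Fin a × Fin b × Fin c) = (i₀, j₀, l₀)
  · simp only [Prod.mk.injEq] at h
    obtain ⟨rfl, rfl, rfl⟩ := h
    simp
  · simp [h]

/-- **The Jacobian of `Φ` at `(1, ψ)` is invertible as soon as a maximal minor of the tangent map
is.** Let `row : Fin d → (basis triples)` enumerate the basis triples of negative `H`-weight
bijectively and `col : Fin d → LVar` choose `d` lowering operators such that the `d × d` minor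
`(tangentEntry ψ (row q) (col q'))` of the tangent map has non-zero determinant. Then for the
column choice `e` (coordinate `φ_ρ` for `ρ` of non-negative weight, lowering variable `col q` for
`ρ = row q`) the Jacobian `(∂Φ_ρ/∂e(ρ'))` of `Φ` has non-zero determinant in the polynomial ring:
at the base point it is block triangular with diagonal blocks the identity and that minor.
[cite: VergneWalter2014, proof of Prop. 3.13 and Def. 3.14] -/
theorem exists_det_jacobian_genImage_ne_zero (hA : Fin a → ℤ) (hB : Fin b → ℤ) (hC : Fin c → ℤ)
    (z : ℤ) {ψ : Fin a → Fin b → Fin c → ℤ} (hψ : ∀ i j l, hA i + hB j + hC l + z < 0 → ψ i j l = 0)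
    {d : ℕ} (row : Fin d → Fin a × Fin b × Fin c)
    (hrow : ∀ q, hA (row q).1 + hB (row q).2.1 + hC (row q).2.2 + z < 0)
    (hinj : Function.Injective row)
    (hsurj : ∀ ρ : Fin a × Fin b × Fin c, hA ρ.1 + hB ρ.2.1 + hC ρ.2.2 + z < 0 → ∃ q, row q = ρ)
    (col : Fin d → LVar a b c)
    (hdet : (Matrix.of fun q q' : Fin d => tangentEntry ψ (row q) (col q')).det ≠ 0) :
    ∃ e : Fin a × Fin b × Fin c → MVar a b c,
      (Matrix.of fun ρ ρ' => pderiv (e ρ') (genImage hA hB hC z ρ)).det ≠ 0 := by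
  classical
  -- the column choice
  have hidx : ∀ ρ : Fin a × Fin b × Fin c, ∀ h : hA ρ.1 + hB ρ.2.1 + hC ρ.2.2 + z < 0,
      row (hsurj ρ h).choose = ρ := fun ρ h => (hsurj ρ h).choose_spec
  let e : Fin a × Fin b × Fin c → MVar a b c := fun ρ =>
    if h : hA ρ.1 + hB ρ.2.1 + hC ρ.2.2 + z < 0 then Sum.inl (col (hsurj ρ h).choose) else Sum.inr ρ
  refine ⟨e, ?_⟩
  set J : Matrix (Fin a × Fin b × Fin c) (Fin a × Fin b × Fin c) (MvPolynomial (MVar a b c) ℂ) :=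
    Matrix.of fun ρ ρ' => pderiv (e ρ') (genImage hA hB hC z ρ) with hJ
  -- it suffices to evaluate at the base point
  suffices h : (J.map (eval (basePoint ψ))).det ≠ 0 by
    intro h0
    apply h
    rw [← RingHom.mapMatrix_apply, ← RingHom.map_det, h0, map_zero]
  set Jx := J.map (eval (basePoint ψ)) with hJx
  -- entries of the evaluated Jacobian
  have hent : ∀ ρ ρ', Jx ρ ρ' = if h : hA ρ'.1 + hB ρ'.2.1 + hC ρ'.2.2 + z < 0 then
      (tangentEntry ψ ρ (col (hsurj ρ' h).choose) : ℂ) else (if ρ = ρ' then 1 else 0) := by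
    intro ρ ρ'
    rw [hJx, Matrix.map_apply, hJ, Matrix.of_apply]
    by_cases h : hA ρ'.1 + hB ρ'.2.1 + hC ρ'.2.2 + z < 0
    · simp only [e, dif_pos h]
      exact eval_basePoint_pderiv_inl_genImage hA hB hC z hψ _ _
    · simp only [e, dif_neg h]
      rw [eval_basePoint_pderiv_inr_genImage hA hB hC z hψ]
      simp [not_lt.1 h]
  -- block decomposition along `p ρ = (ω(ρ) ≥ 0)`
  let p : Fin a × Fin b × Fin c → Prop := fun ρ => ¬ hA ρ.1 + hB ρ.2.1 + hC ρ.2.2 + z < 0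
  have hblock : ∀ ρ, ¬ p ρ → ∀ ρ', p ρ' → Jx ρ ρ' = 0 := by
    intro ρ hρ ρ' hρ'
    rw [hent, dif_neg hρ', if_neg]
    rintro rfl
    exact hρ hρ'
  rw [Matrix.twoBlockTriangular_det Jx p hblock]
  -- the `p`-block is the identity
  have h1 : Matrix.toSquareBlockProp Jx p = 1 := by
    ext ⟨ρ, hρ⟩ ⟨ρ', hρ'⟩
    rw [Matrix.toSquareBlockProp_def, Matrix.of_apply, hent, dif_neg hρ', Matrix.one_apply]
    simp only [Subtype.mk.injEq]
  -- the `¬p`-block is the minor of the tangent map, reindexed along `row`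
  have hnp : ∀ q, ¬ p (row q) := fun q h => h (hrow q)
  let ε : Fin d ≃ {ρ // ¬ p ρ} := Equiv.ofBijective (fun q => ⟨row q, hnp q⟩)
    ⟨fun q q' h => hinj (congrArg Subtype.val h), fun ⟨ρ, hρ⟩ => by
      obtain ⟨q, hq⟩ := hsurj ρ (not_not.1 hρ)
      exact ⟨q, Subtype.ext hq⟩⟩
  have h2 : (Matrix.toSquareBlockProp Jx fun ρ => ¬ p ρ).submatrix ε ε =
      (Matrix.of fun q q' : Fin d => tangentEntry ψ (row q) (col q')).map (Int.castRingHom ℂ) := by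
    ext q q'
    rw [Matrix.submatrix_apply, Matrix.toSquareBlockProp_def, Matrix.of_apply, Matrix.map_apply,
      Matrix.of_apply]
    change Jx (row q) (row q') = _
    rw [hent, dif_pos (hrow q')]
    have hq : (hsurj (row q') (hrow q')).choose = q' := hinj (hidx _ (hrow q'))
    rw [hq]
    rfl
  have h3 : (Matrix.toSquareBlockProp Jx fun ρ => ¬ p ρ).det =
      ((Matrix.of fun q q' : Fin d => tangentEntry ψ (row q) (col q')).det : ℂ) := by
    rw [← Matrix.det_submatrix_equiv_self ε, h2, ← RingHom.mapMatrix_apply, ← RingHom.map_det]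
    rfl
  rw [h1, Matrix.det_one, one_mul, h3]
  exact_mod_cast hdet

end Tangent

/-! ## §7 Vergne–Walter's criterion: a non-vanishing minor of the tangent map gives a valid
inequality for all occurring triples -/

section Main

variable {a b c n : ℕ}

/-- **[VergneWalter2014, Prop. 3.13] — inequalities for Kronecker (and moment) polytopes from
the tangent map.** Let `H = (H_A, H_B, H_C, z)` be integer data, `ω(i,j,l) = H_A i + H_B j + H_C l + z`
the `H`-weight of the basis triple `eᵢ ⊗ eⱼ ⊗ eₗ`, and let `ψ` be an integer tensor supported on
`{ω ≥ 0}` (`ψ ∈ ℋ(H ≥ 0)`). Suppose the tangent map `𝔫₋ → ℋ(H < 0)`, `X ↦ (X·ψ)|_{ℋ(H<0)}` is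
surjective, witnessed by a bijective enumeration `row` of the basis triples of negative weight
and a choice `col` of as many lowering operators with invertible minor
`det (tangentEntry ψ (row q) (col q')) ≠ 0`. Then for every tensor `s ∈ ℂᵃ ⊗ ℂᵇ ⊗ ℂᶜ` and every
partition triple `λ ⊢ n` occurring in `s^{⊗n}` (non-vanishing triple isotypic character sum),
`(H, λ) = ∑ᵢ H_A i λ⁰ᵢ + ∑ⱼ H_B j λ¹ⱼ + ∑ₗ H_C l λ²ₗ + z·n ≥ 0`. In particular `(H, -) ≥ 0` is
valid on the Kronecker polytope `Kron(a,b,c)` and on every moment polytope `Δ(s)`.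
Proof: occurrence gives a triad of highest-weight vectors `ξ` and matrices with
`P_ξ((A⊗B⊗C)s) ≠ 0` (§5, `pairingPoly_ne_zero`); if `(H, λ) < 0` then `P_ξ ∘ Φ = 0` (§5), and the
Jacobian of `Φ` has an invertible maximal minor (§6), so `P_ξ = 0` (§1) — contradiction.
[cite: VergneWalter2014, Prop. 3.13, Def. 3.14 and §6.2] -/
theorem hPairing_nonneg_of_occurs_of_det_tangentMinor_ne_zero (hA : Fin a → ℤ) (hB : Fin b → ℤ)
    (hC : Fin c → ℤ) (z : ℤ) (ψ : Fin a → Fin b → Fin c → ℤ)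
    (hψ : ∀ i j l, hA i + hB j + hC l + z < 0 → ψ i j l = 0)
    {d : ℕ} (row : Fin d → Fin a × Fin b × Fin c)
    (hrow : ∀ q, hA (row q).1 + hB (row q).2.1 + hC (row q).2.2 + z < 0)
    (hinj : Function.Injective row)
    (hsurj : ∀ ρ : Fin a × Fin b × Fin c, hA ρ.1 + hB ρ.2.1 + hC ρ.2.2 + z < 0 → ∃ q, row q = ρ)
    (col : Fin d → LVar a b c)
    (hdet : (Matrix.of fun q q' : Fin d => tangentEntry ψ (row q) (col q')).det ≠ 0)
    {lam : Fin 3 → Nat.Partition n} {s : Fin a → Fin b → Fin c → ℂ}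
    (hocc : isotypicSum₁ (lam 0) (isotypicSum₂ (lam 1) (isotypicSum₃ (lam 2) (kroneckerPow s n))) ≠ 0) :
    0 ≤ hPairing hA hB hC z lam := by
  classical
  by_contra hneg
  rw [not_le] at hneg
  obtain ⟨A, B, C, ξ₁, ξ₂, ξ₃, h₁, h₂, h₃, hne⟩ :=
    exists_pairing_ne_zero_of_isotypicSum₁₂₃_kroneckerPow_ne_zero hocc
  obtain ⟨e, hJ⟩ := exists_det_jacobian_genImage_ne_zero hA hB hC z hψ row hrow hinj hsurj col hdet
  exact pairingPoly_ne_zero hne (eq_zero_of_aeval_eq_zero_of_det_jacobian_ne_zero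
    (genImage hA hB hC z) e hJ (aeval_genImage_pairingPoly_eq_zero hA hB hC z h₁ h₂ h₃ hneg))

end Main

/-! ## §8 From a positive Kronecker coefficient to an occurring triple -/

section Kronecker

open Literature.NumberTheory.DiophantineGeometry (Word3 zip3 permute3 zip3_symm_comp tripleHw
  mem_tripleHw_iff wordPoly eq_zero_of_wordPoly_eq_zero exists_invariant_of_kroneckerCoeff_pos
  kroneckerCoeff)
open Literature.RepresentationTheory.FiniteGroups (wordIsotypicMatrix)

variable {N n : ℕ}

/-- An element of the triple slice space `HW_λ ⊗ HW_μ ⊗ HW_ν` (curried) is fixed by the triple of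
isotypic projector matrices `P_λ ⊗ P_μ ⊗ P_ν` (each slice is fixed,
`wordIsotypicMatrix_mulVec_of_mem_highestWeightSpace`). [cite: ChristandlVranaZuiddam2023, §3.1] -/
theorem actTensor_wordIsotypicMatrix_of_mem_tripleHw {lam mu nu : Nat.Partition n}
    {M : Word3 N n → ℂ} (hM : M ∈ tripleHw ℂ N n (Weight.ofPartition N lam)
      (Weight.ofPartition N mu) (Weight.ofPartition N nu)) :
    actTensor (wordIsotypicMatrix N n lam) (wordIsotypicMatrix N n mu) (wordIsotypicMatrix N n nu)
      (fun u v w => M ((u, v), w)) = fun u v w => M ((u, v), w) := by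
  obtain ⟨h1, h2, h3⟩ := (mem_tripleHw_iff _ _ _ _).1 hM
  have e3 : ∀ u v w, ∑ w', wordIsotypicMatrix N n nu w w' * M ((u, v), w') = M ((u, v), w) :=
    fun u v w => congrFun (wordIsotypicMatrix_mulVec_of_mem_highestWeightSpace (h3 u v)) w
  have e2 : ∀ u v w, ∑ v', wordIsotypicMatrix N n mu v v' * M ((u, v'), w) = M ((u, v), w) :=
    fun u v w => congrFun (wordIsotypicMatrix_mulVec_of_mem_highestWeightSpace (h2 u w)) v
  have e1 : ∀ u v w, ∑ u', wordIsotypicMatrix N n lam u u' * M ((u', v), w) = M ((u, v), w) :=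
    fun u v w => congrFun (wordIsotypicMatrix_mulVec_of_mem_highestWeightSpace (h1 v w)) u
  funext u v w
  rw [actTensor_apply]
  calc ∑ u', ∑ v', ∑ w', wordIsotypicMatrix N n lam u u' * wordIsotypicMatrix N n mu v v' *
          wordIsotypicMatrix N n nu w w' * M ((u', v'), w')
      = ∑ u', wordIsotypicMatrix N n lam u u' * ∑ v', wordIsotypicMatrix N n mu v v' *
          ∑ w', wordIsotypicMatrix N n nu w w' * M ((u', v'), w') := by
        simp only [Finset.mul_sum, mul_assoc]
    _ = M ((u, v), w) := by simp only [e3, e2, e1]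

/-- **A pairing with an element of `HW_λ ⊗ HW_μ ⊗ HW_ν` detects occurrence**: if
`⟪s^{⊗n}, M⟫ ≠ 0` for some `M` in the triple slice space of weights `λ, μ, ν`, then the triple
occurs in `s^{⊗n}` (as `isotypicSum₁₂₃_kroneckerPow_ne_zero_of_pairing_ne_zero`, with the triad
replaced by `M`: `M` is fixed by the symmetric projector `P_λ ⊗ P_μ ⊗ P_ν`).
[cite: BurgisserIkenmeyer2011, §3.1 and §10.1] -/
theorem isotypicSum₁₂₃_kroneckerPow_ne_zero_of_pairing_tripleHw_ne_zero {lam : Fin 3 → Nat.Partition n}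
    {M : Word3 N n → ℂ} (hM : M ∈ tripleHw ℂ N n (Weight.ofPartition N (lam 0))
      (Weight.ofPartition N (lam 1)) (Weight.ofPartition N (lam 2)))
    {s : Fin N → Fin N → Fin N → ℂ}
    (h : ∑ u, ∑ v, ∑ w, kroneckerPow s n u v w * M ((u, v), w) ≠ 0) :
    isotypicSum₁ (lam 0) (isotypicSum₂ (lam 1) (isotypicSum₃ (lam 2) (kroneckerPow s n))) ≠ 0 := by
  rw [isotypicSum₁₂₃_ne_zero_iff]
  intro h0
  apply h
  have hfix := actTensor_wordIsotypicMatrix_of_mem_tripleHw hM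
  calc ∑ u, ∑ v, ∑ w, kroneckerPow s n u v w * M ((u, v), w)
      = ∑ u, ∑ v, ∑ w, kroneckerPow s n u v w *
          actTensor (wordIsotypicMatrix N n (lam 0)) (wordIsotypicMatrix N n (lam 1))
            (wordIsotypicMatrix N n (lam 2)) (fun u v w => M ((u, v), w)) u v w := by rw [hfix]
    _ = 0 := by
        rw [sum_mul_actTensor, transpose_wordIsotypicMatrix, transpose_wordIsotypicMatrix,
          transpose_wordIsotypicMatrix, h0]
        simp

/-- **A positive Kronecker coefficient is witnessed by an occurring triple.** If
`g(λ⁰, λ¹, λ²) > 0` for partitions of `n` with at most `N` parts, then the triple occurs in the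
`n`-th tensor power of SOME tensor `s ∈ ℂᴺ ⊗ ℂᴺ ⊗ ℂᴺ` (indeed of a generic one): a nonzero
`S_n`-invariant `M ∈ HW ⊗ HW ⊗ HW` (`exists_invariant_of_kroneckerCoeff_pos`) has nonzero word
polynomial `∑_w M(w) X^w` (`eq_zero_of_wordPoly_eq_zero`), whose value at `s` is `⟪s^{⊗n}, M⟫`.
So the Kronecker polytope `Kron(N,N,N)` (closure of normalised triples with `g > 0`) is the union
of the moment polytopes `Δ(s)`, and inequalities valid for all occurring triples
(`hPairing_nonneg_of_occurs_of_det_tangentMinor_ne_zero`) are valid for all triples with `g > 0`.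
[cite: BurgisserIkenmeyer2011, §3.1–3.2] [cite: VergneWalter2014, §6 (Kronecker cones)] -/
theorem exists_occurs_of_kroneckerCoeff_pos {lam : Fin 3 → Nat.Partition n}
    (hcard : ∀ j, (lam j).parts.card ≤ N) (hg : 0 < kroneckerCoeff ℂ (lam 0) (lam 1) (lam 2)) :
    ∃ s : Fin N → Fin N → Fin N → ℂ,
      isotypicSum₁ (lam 0) (isotypicSum₂ (lam 1) (isotypicSum₃ (lam 2) (kroneckerPow s n))) ≠ 0 := by
  classical
  obtain ⟨M, hM, hM0, hinv⟩ :=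
    exists_invariant_of_kroneckerCoeff_pos (k := ℂ) (hcard 0) (hcard 1) (hcard 2) hg
  -- the word polynomial of `M` (in the zipped alphabet) is nonzero
  set F : (Fin n → (Fin N × Fin N) × Fin N) → ℂ := fun w => M (zip3.symm w) with hF
  have hFinv : ∀ (τ : Equiv.Perm (Fin n)) (w : Fin n → (Fin N × Fin N) × Fin N), F (w ∘ ⇑τ) = F w := by
    intro τ w
    simp only [hF, zip3_symm_comp, hinv]
  have hF0 : F ≠ 0 := by
    intro h0
    apply hM0
    funext t
    have := congrFun h0 (zip3 t)
    simpa [hF] using this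
  have hP : wordPoly F ≠ 0 := fun h0 => hF0 (eq_zero_of_wordPoly_eq_zero hFinv h0)
  -- so it does not vanish at some point `x`, i.e. `⟪s^{⊗n}, M⟫ ≠ 0` for the tensor `s = x`
  obtain ⟨x, hx⟩ : ∃ x : (Fin N × Fin N) × Fin N → ℂ, eval x (wordPoly F) ≠ 0 := by
    by_contra hall
    push Not at hall
    exact hP (MvPolynomial.funext fun x => by rw [hall x, map_zero])
  refine ⟨fun i j l => x ((i, j), l), isotypicSum₁₂₃_kroneckerPow_ne_zero_of_pairing_tripleHw_ne_zero hM ?_⟩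
  have heval : eval x (wordPoly F) = ∑ w : Fin n → (Fin N × Fin N) × Fin N, F w * ∏ p, x (w p) := by
    simp only [wordPoly, map_sum, smul_eval, ← prod_X_eq_monomial_wordExp, map_prod, eval_X]
  rw [heval, ← Equiv.sum_comp (zip3 (N := N) (n := n))] at hx
  rw [Fintype.sum_prod_type, Fintype.sum_prod_type] at hx
  convert hx using 1
  refine Finset.sum_congr rfl fun u _ => Finset.sum_congr rfl fun v _ =>
    Finset.sum_congr rfl fun w _ => ?_
  simp only [hF, Equiv.symm_apply_apply, kroneckerPow_apply, mul_comm (M _)]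
  rfl

end Kronecker

/-! ## §9 Corollaries in certificate form -/

section Certificate

open Literature.NumberTheory.DiophantineGeometry (kroneckerCoeff)

variable {N n : ℕ}

/-- **Vergne–Walter's criterion for the Kronecker polytope `Kron(N,N,N)`**: under the tangent-map
certificate of `hPairing_nonneg_of_occurs_of_det_tangentMinor_ne_zero`, the inequality
`(H, λ) ≥ 0` holds for every partition triple `λ ⊢ n` with at most `N` parts and positive
Kronecker coefficient `g(λ⁰, λ¹, λ²) > 0` (§8: such a triple occurs in `s^{⊗n}` for some
`s ∈ ℂᴺ ⊗ ℂᴺ ⊗ ℂᴺ`). [cite: VergneWalter2014, Prop. 3.13, Thm. 1.1 and §6] -/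
theorem hPairing_nonneg_of_kroneckerCoeff_pos_of_det_tangentMinor_ne_zero (hA hB hC : Fin N → ℤ)
    (z : ℤ) (ψ : Fin N → Fin N → Fin N → ℤ) (hψ : ∀ i j l, hA i + hB j + hC l + z < 0 → ψ i j l = 0)
    {d : ℕ} (row : Fin d → Fin N × Fin N × Fin N)
    (hrow : ∀ q, hA (row q).1 + hB (row q).2.1 + hC (row q).2.2 + z < 0)
    (hinj : Function.Injective row)
    (hsurj : ∀ ρ : Fin N × Fin N × Fin N, hA ρ.1 + hB ρ.2.1 + hC ρ.2.2 + z < 0 → ∃ q, row q = ρ)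
    (col : Fin d → LVar N N N)
    (hdet : (Matrix.of fun q q' : Fin d => tangentEntry ψ (row q) (col q')).det ≠ 0)
    {lam : Fin 3 → Nat.Partition n} (hcard : ∀ j, (lam j).parts.card ≤ N)
    (hg : 0 < kroneckerCoeff ℂ (lam 0) (lam 1) (lam 2)) :
    0 ≤ hPairing hA hB hC z lam := by
  obtain ⟨s, hs⟩ := exists_occurs_of_kroneckerCoeff_pos hcard hg
  exact hPairing_nonneg_of_occurs_of_det_tangentMinor_ne_zero hA hB hC z ψ hψ row hrow hinj hsurj
    col hdet hs

/-- A square integer matrix with a right "inverse up to a non-zero scalar" has non-zero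
determinant (the certificate format of `Kron444Facets.lean`). [folklore] -/
theorem det_ne_zero_of_mul_eq_smul_one {d : ℕ} {M R : Matrix (Fin d) (Fin d) ℤ} {D : ℤ}
    (h : M * R = D • (1 : Matrix (Fin d) (Fin d) ℤ)) (hD : D ≠ 0) : M.det ≠ 0 := by
  intro h0
  have h1 := congrArg Matrix.det h
  rw [Matrix.det_mul, h0, zero_mul, Matrix.det_smul, Matrix.det_one, mul_one, Fintype.card_fin] at h1
  exact pow_ne_zero d hD h1.symm

end Certificate




end Literature.Computability.AlgebraicComplexity
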